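import Summits.CriticalPhenomena.CardyFormulaZ2.Theorems.CardyIKTransportIKLinearTransportStubCrudeCardySiteTriPart3
import Summits.CriticalPhenomena.CardyFormulaZ2.Theorems.CardyIKTransportIKLinearTransportGlue
import Literature.Probability.Percolation.CornerPercolation

/-!
# Crude Cardy for site percolation on `𝕋` with general slack — Part 4: the shear `K₀` and the stub
# `stub_CrudeCardySiteTri`

Support file (`--supports stmt-CriticalPhenomena-5076`) of the line `pinned-diagram-exchange` of the crux
`CardyIKTransport.IKLinearTransport` (stmt-CriticalPhenomena-5076), closing the registered stub
`stub_CrudeCardySiteTri` of the lead's skeleton (v3):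

  `∃ K₀ : ℂ ≃L[ℝ] ℂ, IsTriShear K₀ ∧ ∀ R, HasCrossingLimit (R.map K₀) (δ ↦ P_{1/2}[siteTriCrudeEvent R δ]) F`

— crude Cardy for fair site percolation on `triGraph` drawn on the square grid (`sqEmb`), read in the
images of the explicit shear `K₀ : x + iy ↦ x + yζ`, `ζ = e^{iπ/3}` (so `K₀ ∘ sqEmb = triEmbed`,
`exists_triShear`, `triShear_sqEmb`). The colour-level event `siteTriCrudeEvent R δ` (black `triGraph`-edges
of the all-anti triangulation in the square drawing, crude embedded crossing `embDomainCrossing sqEmb`) is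
sandwiched between G02's crossing event of the sheared rectangle `K₀ R` on `δ𝕋`
(`triCrossing_subset_siteTriCrudeEvent`: `‖K₀⁻¹‖ ≤ 2`, discrete-arc sites within `δ` of their arc) and
the slack-`4` crude event of `K₀ R` (`siteTriCrudeEvent_subset`: `‖K₀‖ ≤ 2`; degenerate one-site
crossings are void once `6δ ≤ dist(A₁, A₃)`); Smirnov's theorem
(`hasCrossingLimit_triDomainCrossingProb_holds`) bounds from below and `crude_upper` (Part 3) from above.

References: S. Smirnov, C. R. Acad. Sci. Paris 333 (2001), Thm. 1 and §2; B. Bollobás, O. Riordan,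
*Percolation*, CUP (2006), Ch. 7, Thm. 2 p. 165, Lemma 14 p. 184; G. Grimmett, *Percolation* (1999), §1.6.
-/

noncomputable section

namespace Summit.CriticalPhenomena.CardyFormulaZ2.Theorems.IKLinearTransport.PinnedDiagramExchange

open scoped BigOperators Topology Classical MeasureTheory
open Filter Set Function MeasureTheory Metric
open Literature.Probability.Percolation Literature.Probability.LatticeModels
open Literature.Probability.RandomPlanarGeometry

/-! ## §9 The shear `K₀` -/

/-- **The explicit shear** `K₀ : x + iy ↦ x + yζ` (`ζ = e^{iπ/3}`) as a real-linear automorphism of `ℂ`,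
with the crude bi-Lipschitz bounds `‖K₀ z‖ ≤ 2‖z‖`, `‖z‖ ≤ 2‖K₀ z‖` (`‖K₀ z‖² = x² + xy + y²`). [folklore] -/
theorem exists_triShear : ∃ K₀ : ℂ ≃L[ℝ] ℂ, IsTriShear K₀ ∧ (∀ z, ‖K₀ z‖ ≤ 2 * ‖z‖) ∧ ∀ z, ‖z‖ ≤ 2 * ‖K₀ z‖ := by
  let L : ℂ →ₗ[ℝ] ℂ :=
    { toFun := fun z => (z.re : ℂ) + (z.im : ℂ) * triZeta
      map_add' := fun z w => by simp only [Complex.add_re, Complex.add_im, Complex.ofReal_add]; ring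
      map_smul' := fun r z => by
        simp only [Complex.real_smul, Complex.re_ofReal_mul, Complex.im_ofReal_mul, Complex.ofReal_mul,
          RingHom.id_apply]
        ring }
  have hL : ∀ z, L z = (z.re : ℂ) + (z.im : ℂ) * triZeta := fun z => rfl
  have hnorm : ∀ z : ℂ, ‖L z‖ ^ 2 = z.re ^ 2 + z.re * z.im + z.im ^ 2 := fun z => by
    rw [hL, Complex.sq_norm, normSq_add_mul_triZeta]
  have hz2 : ∀ z : ℂ, ‖z‖ ^ 2 = z.re ^ 2 + z.im ^ 2 := fun z => by
    rw [Complex.sq_norm, Complex.normSq_apply]; ring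
  have hup : ∀ z, ‖L z‖ ≤ 2 * ‖z‖ := fun z => by
    have h : ‖L z‖ ^ 2 ≤ (2 * ‖z‖) ^ 2 := by
      rw [hnorm, mul_pow, hz2]; nlinarith [sq_nonneg (z.re - z.im), sq_nonneg z.re, sq_nonneg z.im]
    exact (pow_le_pow_iff_left₀ (norm_nonneg _) (by positivity) two_ne_zero).1 h
  have hlow : ∀ z, ‖z‖ ≤ 2 * ‖L z‖ := fun z => by
    have h : ‖z‖ ^ 2 ≤ (2 * ‖L z‖) ^ 2 := by
      rw [hz2, mul_pow, hnorm]; nlinarith [sq_nonneg (z.re + z.im), sq_nonneg z.re, sq_nonneg z.im]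
    exact (pow_le_pow_iff_left₀ (norm_nonneg _) (by positivity) two_ne_zero).1 h
  have hinj : Function.Injective L := fun z w h => by
    have h0 : L (z - w) = 0 := by rw [map_sub, h, sub_self]
    have h1 : ‖z - w‖ ≤ 2 * ‖L (z - w)‖ := hlow (z - w)
    rw [h0, norm_zero, mul_zero] at h1
    exact sub_eq_zero.1 (norm_le_zero_iff.1 h1)
  refine ⟨(LinearEquiv.ofInjectiveEndo L hinj).toContinuousLinearEquiv, fun z => ?_, fun z => ?_, fun z => ?_⟩
  · show L z = _; rfl
  · show ‖L z‖ ≤ _; exact hup z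
  · show ‖z‖ ≤ 2 * ‖L z‖; exact hlow z

/-! ## §10 The colour-level crude event of the square drawing and its transport by `K₀` -/

/-- **An open edge of the `S = ∅` drawing joins two black `𝕋`-neighbours** (the unit vectors of `ℤ²` as
`Pi.single`: `vec10_eq_single`, `vec01_eq_single` of `CornerPercolation.lean`). [folklore] -/
theorem mem_blackEdges_univ {A : Set (Site 2)} {a b : Site 2}
    (h : s(a, b) ∈ blackEdges (A, (Set.univ : Set (Site 2)))) : a ∈ A ∧ b ∈ A ∧ triGraph.Adj a b := by
  simp only [blackEdges, Set.mem_setOf_eq] at h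
  obtain ⟨u, v, huv, hu, hv, hrel⟩ := h
  have hadj : triGraph.Adj u v := by
    rw [triGraph_adj_iff]
    rcases hrel with h | h | ⟨-, hnot⟩ | ⟨h, -⟩
    · exact Or.inl ((zdGraph_adj_iff u v).2 ⟨0, Or.inl (by rw [h, vec10_eq_single])⟩)
    · exact Or.inl ((zdGraph_adj_iff u v).2 ⟨1, Or.inl (by rw [h, vec01_eq_single])⟩)
    · exact absurd (Set.mem_univ _) hnot
    · exact Or.inr (Or.inl h)
  rcases Sym2.eq_iff.1 huv with ⟨rfl, rfl⟩ | ⟨rfl, rfl⟩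
  · exact ⟨hu, hv, hadj⟩
  · exact ⟨hv, hu, hadj.symm⟩

/-- **Two black `𝕋`-neighbours span an open edge of the `S = ∅` drawing.** [folklore] -/
theorem mem_blackEdges_univ_of_adj (A : Set (Site 2)) {a b : Site 2} (ha : a ∈ A) (hb : b ∈ A)
    (h : triGraph.Adj a b) : s(a, b) ∈ blackEdges (A, (Set.univ : Set (Site 2))) := by
  simp only [blackEdges, Set.mem_setOf_eq]
  rw [triGraph_adj_iff] at h
  rcases h with h | h | h
  · obtain ⟨i, h | h⟩ := (zdGraph_adj_iff a b).1 h
    · refine ⟨a, b, rfl, ha, hb, ?_⟩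
      revert h
      refine Fin.cases ?_ (fun j => ?_) i
      · intro h; exact Or.inl (by rw [h, vec10_eq_single])
      · intro h
        have hj : j = 0 := Subsingleton.elim _ _
        subst hj
        exact Or.inr (Or.inl (by rw [h, vec01_eq_single]; rfl))
    · refine ⟨b, a, Sym2.eq_swap, hb, ha, ?_⟩
      revert h
      refine Fin.cases ?_ (fun j => ?_) i
      · intro h; exact Or.inl (by rw [h, vec10_eq_single])
      · intro h
        have hj : j = 0 := Subsingleton.elim _ _
        subst hj
        exact Or.inr (Or.inl (by rw [h, vec01_eq_single]; rfl))
  · exact ⟨a, b, rfl, ha, hb, Or.inr (Or.inr (Or.inr ⟨h, Set.mem_univ _⟩))⟩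
  · exact ⟨b, a, Sym2.eq_swap, hb, ha, Or.inr (Or.inr (Or.inr ⟨h, Set.mem_univ _⟩))⟩

/-- **The shear carries the square drawing to the equilateral one**: `K₀ (δ · sqEmb y) = δ · triEmbed y`.
[folklore] -/
theorem triShear_sqEmb {K₀ : ℂ ≃L[ℝ] ℂ} (hK : IsTriShear K₀) (δ : ℝ) (y : Site 2) :
    K₀ ((δ : ℂ) * sqEmb y) = triMeshPoint δ y := by
  rw [hK]
  have hre : ((δ : ℂ) * sqEmb y).re = δ * (y 0 : ℝ) := by simp [sqEmb]
  have him : ((δ : ℂ) * sqEmb y).im = δ * (y 1 : ℝ) := by simp [sqEmb]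
  rw [hre, him, triMeshPoint, triEmbed]
  push_cast
  ring

/-- **Upper transport**: the colour-level crude event of the square drawing of `R` is contained in the
crude event with slack `4` of the sheared rectangle `K₀ R` on `𝕋` (for `6δ ≤ dist(A₁, A₃)`, which rules
out degenerate one-site crossings): `K₀` is real-linear with `‖K₀‖ ≤ 2`, and an open edge of the drawing
joins two black `𝕋`-neighbours. [folklore] -/
theorem siteTriCrudeEvent_subset (R : ConformalRectangle) {K₀ : ℂ ≃L[ℝ] ℂ} (hK : IsTriShear K₀)
    (h2 : ∀ z, ‖K₀ z‖ ≤ 2 * ‖z‖) {δ : ℝ} (hδ : 0 < δ) (hfar : ∀ a ∈ R.arc 0, ∀ b ∈ R.arc 2, 6 * δ ≤ dist a b) :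
    siteTriCrudeEvent R δ ⊆ {A : Set (Site 2) | ∃ u v : Site 2,
      infDist (triMeshPoint δ u) ((R.map K₀.toHomeomorph).arc 0) ≤ 4 * δ ∧
      infDist (triMeshPoint δ v) ((R.map K₀.toHomeomorph).arc 2) ≤ 4 * δ ∧
      A ∈ siteConnIn triGraph (triMeshVertices (R.map K₀.toHomeomorph).carrier δ) u v} := by
  have hdistK : ∀ z w, dist (K₀ z) (K₀ w) ≤ 2 * dist z w := fun z w => by
    rw [dist_eq_norm, dist_eq_norm, ← map_sub]; exact h2 _
  have harc : ∀ i, (R.map K₀.toHomeomorph).arc i = K₀ '' R.arc i := fun i => by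
    rw [MarkedDomain.arc_map]; rfl
  set S : Set (Site 2) := {y | (δ : ℂ) * sqEmb y ∈ R.carrier} with hSdef
  have hS : S = triMeshVertices (R.map K₀.toHomeomorph).carrier δ := by
    ext y
    rw [mem_triMeshVertices_iff, MarkedDomain.carrier_map, ← triShear_sqEmb hK δ y]
    exact (K₀.injective.mem_set_image).symm
  rintro A hA
  simp only [siteTriCrudeEvent, Set.mem_setOf_eq, mem_embDomainCrossing_iff] at hA
  obtain ⟨u, hu, v, hv, huS, hvS, hreach⟩ := hA
  obtain ⟨W⟩ := hreach
  -- no degenerate crossings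
  have huv : u ≠ v := by
    rintro rfl
    obtain ⟨a, ha, hua⟩ := (infDist_lt_iff ⟨_, R.pt_mem_arc_self 0⟩).1 (hu.trans_lt (by linarith : 2 * δ < 3 * δ))
    obtain ⟨b, hb, hub⟩ := (infDist_lt_iff ⟨_, R.pt_mem_arc_self 2⟩).1 (hv.trans_lt (by linarith : 2 * δ < 3 * δ))
    have h1 := hfar a ha b hb
    have h2 := dist_triangle a ((δ : ℂ) * sqEmb u) b
    have h3 : dist a ((δ : ℂ) * sqEmb u) < 3 * δ := by rwa [dist_comm] at hua
    linarith
  -- the open walk is a black `𝕋`-path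
  have step : ∀ p q : S, ((openGraph (blackEdges (A, (Set.univ : Set (Site 2))))).induce S).Adj p q →
      p.1 ∈ A ∧ q.1 ∈ A ∧ triGraph.Adj p.1 q.1 := by
    intro p q hpq
    have h' : (openGraph (blackEdges (A, (Set.univ : Set (Site 2))))).Adj p.1 q.1 := hpq
    rw [openGraph_adj] at h'
    exact mem_blackEdges_univ h'.1
  have claim : ∀ (p q : S) (W' : ((openGraph (blackEdges (A, (Set.univ : Set (Site 2))))).induce S).Walk p q),
      p.1 ∈ A → PathIn triGraph (S ∩ A) p.1 q.1 := by
    intro p q W'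
    induction W' with
    | @nil p' => exact fun hp => PathIn.refl (show p'.1 ∈ S ∩ A from ⟨p'.2, hp⟩)
    | @cons p' q' r' hadj W'' ih =>
      intro hp
      obtain ⟨-, hbA, hab⟩ := step _ _ hadj
      exact (PathIn.of_adj (show p'.1 ∈ S ∩ A from ⟨p'.2, hp⟩) (show q'.1 ∈ S ∩ A from ⟨q'.2, hbA⟩) hab).trans (ih hbA)
  have huA : u ∈ A := by
    cases W with
    | nil => exact absurd rfl huv
    | cons hadj _ => exact (step _ _ hadj).1
  have hpath : PathIn triGraph (S ∩ A) u v := claim ⟨u, huS⟩ ⟨v, hvS⟩ W huA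
  rw [hS] at hpath
  refine ⟨u, v, ?_, ?_, mem_siteConnIn_iff_pathIn.2 hpath⟩
  · rw [harc 0, ← triShear_sqEmb hK δ u]
    exact (infDist_image_le_of_dist_le two_pos hdistK _ _).trans (by linarith)
  · rw [harc 2, ← triShear_sqEmb hK δ v]
    exact (infDist_image_le_of_dist_le two_pos hdistK _ _).trans (by linarith)

/-- **Lower transport**: G02's crossing event of the sheared rectangle `K₀ R` on `δ𝕋` is contained in the
colour-level crude event of the square drawing of `R` (`‖K₀⁻¹‖ ≤ 2`, discrete-arc sites are within `δ` of
their arc, two black `𝕋`-neighbours span an open edge of the drawing). [folklore] -/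
theorem triCrossing_subset_siteTriCrudeEvent (R : ConformalRectangle) {K₀ : ℂ ≃L[ℝ] ℂ} (hK : IsTriShear K₀)
    (h2' : ∀ z, ‖z‖ ≤ 2 * ‖K₀ z‖) {δ : ℝ} (hδ : 0 < δ) :
    triCrossing (R.map K₀.toHomeomorph).carrier δ ((R.map K₀.toHomeomorph).arc 0) ((R.map K₀.toHomeomorph).arc 2) ⊆
      siteTriCrudeEvent R δ := by
  have hdistK : ∀ z w, dist z w ≤ 2 * dist (K₀ z) (K₀ w) := fun z w => by
    rw [dist_eq_norm, dist_eq_norm, ← map_sub]; exact h2' _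
  have harc : ∀ i, (R.map K₀.toHomeomorph).arc i = K₀ '' R.arc i := fun i => by
    rw [MarkedDomain.arc_map]; rfl
  set S : Set (Site 2) := {y | (δ : ℂ) * sqEmb y ∈ R.carrier} with hSdef
  have hS : S = triMeshVertices (R.map K₀.toHomeomorph).carrier δ := by
    ext y
    rw [mem_triMeshVertices_iff, MarkedDomain.carrier_map, ← triShear_sqEmb hK δ y]
    exact (K₀.injective.mem_set_image).symm
  have hδabs : |δ| = δ := abs_of_pos hδ
  rintro A ⟨x, hx, y, hy, hconn⟩
  simp only [siteTriCrudeEvent, Set.mem_setOf_eq, mem_embDomainCrossing_iff]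
  have hx0 : infDist (triMeshPoint δ x) ((R.map K₀.toHomeomorph).arc 0) ≤ δ := by
    have := infDist_le_of_mem_triDiscreteArc (R.map K₀.toHomeomorph).isOpen hx; rwa [hδabs] at this
  have hy2 : infDist (triMeshPoint δ y) ((R.map K₀.toHomeomorph).arc 2) ≤ δ := by
    have := infDist_le_of_mem_triDiscreteArc (R.map K₀.toHomeomorph).isOpen hy; rwa [hδabs] at this
  have hP := mem_siteConnIn_iff_pathIn.1 hconn
  have hDS : triMeshDomain (R.map K₀.toHomeomorph).carrier δ ⊆ S := by
    rw [hS]; exact triMeshDomain_subset_triMeshVertices _ _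
  have hxS : x ∈ S := hDS hP.1.1
  refine ⟨x, ?_, y, ?_, hxS, hDS hP.right_mem.1, ?_⟩
  · rw [harc 0, ← triShear_sqEmb hK δ x] at hx0
    exact (infDist_le_mul_infDist_image two_pos hdistK _ _).trans (by linarith)
  · rw [harc 2, ← triShear_sqEmb hK δ y] at hy2
    exact (infDist_le_mul_infDist_image two_pos hdistK _ _).trans (by linarith)
  have key : ∀ w, Relation.ReflTransGen (fun a b => (triDiscreteDomainGraph (R.map K₀.toHomeomorph).carrier δ).Adj a b ∧
      b ∈ triMeshDomain (R.map K₀.toHomeomorph).carrier δ ∩ A) x w →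
      ∀ hw : w ∈ S, ((openGraph (blackEdges (A, (Set.univ : Set (Site 2))))).induce S).Reachable ⟨x, hxS⟩ ⟨w, hw⟩ := by
    intro w h
    induction h with
    | refl => intro hw; exact SimpleGraph.Reachable.refl _
    | @tail b c hab hbc ih =>
      intro hc
      have hb : b ∈ triMeshDomain (R.map K₀.toHomeomorph).carrier δ ∩ A :=
        PathIn.right_mem (show PathIn _ _ x b from ⟨hP.1, hab⟩)
      refine (ih (hDS hb.1)).trans (SimpleGraph.Adj.reachable ?_)
      have hadj : triGraph.Adj b c :=
        triMeshGraph_le_triGraph _ _ (triDiscreteDomainGraph_le_triMeshGraph _ _ hbc.1)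
      show (openGraph (blackEdges (A, (Set.univ : Set (Site 2))))).Adj b c
      exact (openGraph_adj _ b c).2 ⟨mem_blackEdges_univ_of_adj A hb.2 hbc.2.2 hadj, hadj.ne⟩
  exact key y hP.2 _

/-- **STUB `stub_CrudeCardySiteTri`** (line `pinned-diagram-exchange`, crux `CardyIKTransport.IKLinearTransport`):
crude Cardy for fair site percolation on `𝕋` drawn on the square grid, read in the images of the explicit
shear `K₀ : x + iy ↦ x + yζ` (`K₀ ∘ sqEmb = triEmbed`). Lower half: Smirnov's theorem
(`hasCrossingLimit_triDomainCrossingProb_holds`) for `K₀ R` and `triCrossing ⊆` the event; upper half: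
the event is inside the slack-`4` crude event of `K₀ R`, whose probability is eventually `≤ F(η) + ε`
(`crude_upper`). [cite: Smirnov2001, Thm. 1] [cite: BollobasRiordan2006, Ch. 7 Thm. 2 p. 165, Lemma 14 p. 184] -/
theorem stub_CrudeCardySiteTri :
    ∃ K₀ : ℂ ≃L[ℝ] ℂ, IsTriShear K₀ ∧ ∀ R : ConformalRectangle,
      ConformalRectangle.HasCrossingLimit (R.map K₀.toHomeomorph)
        (fun δ => (sitePercolation (Site 2) half).real (siteTriCrudeEvent R δ))
        Literature.Probability.RandomPlanarGeometry.cardyFunction := by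
  obtain ⟨K₀, hK, hK2, hK2'⟩ := exists_triShear
  refine ⟨K₀, hK, fun R φ x hφx => ?_⟩
  have hlow := hasCrossingLimit_triDomainCrossingProb_holds (R.map K₀.toHomeomorph) φ x hφx
  rw [Metric.tendsto_nhds] at hlow ⊢
  intro ε hε
  obtain ⟨d₀₂, hd₀₂, hd02⟩ := R.exists_pos_forall_lt_dist_arc
  have hsmall : ∀ᶠ δ in 𝓝[>] (0 : ℝ), δ ∈ Ioo 0 (d₀₂ / 6) := Ioo_mem_nhdsGT (by positivity)
  filter_upwards [crude_upper (R.map K₀.toHomeomorph) (s := 4) (by norm_num) φ x hφx (half_pos hε), hsmall, hlow ε hε]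
    with δ hup hδ hlo
  have h1 : triDomainCrossingProb (R.map K₀.toHomeomorph) δ ≤ (sitePercolation (Site 2) half).real (siteTriCrudeEvent R δ) :=
    measureReal_mono (triCrossing_subset_siteTriCrudeEvent R hK hK2' hδ.1) (measure_ne_top _ _)
  have h2 : (sitePercolation (Site 2) half).real (siteTriCrudeEvent R δ) ≤
      (triSitePercolation half).real {ω | ∃ u v : Site 2,
        infDist (triMeshPoint δ u) ((R.map K₀.toHomeomorph).arc 0) ≤ 4 * δ ∧
        infDist (triMeshPoint δ v) ((R.map K₀.toHomeomorph).arc 2) ≤ 4 * δ ∧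
        ω ∈ siteConnIn triGraph (triMeshVertices (R.map K₀.toHomeomorph).carrier δ) u v} :=
    measureReal_mono (siteTriCrudeEvent_subset R hK hK2 hδ.1 fun a ha b hb => by linarith [hd02 a ha b hb, hδ.2])
      (measure_ne_top _ _)
  rw [Real.dist_eq, abs_lt] at hlo ⊢
  constructor <;> linarith

end Summit.CriticalPhenomena.CardyFormulaZ2.Theorems.IKLinearTransport.PinnedDiagramExchange
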